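import Literature.NumberTheory.LFunctions.CoprimeIdealHarmonicSum
import Literature.NumberTheory.LFunctions.IdealMultiplicativeDivisorSums
import Literature.NumberTheory.Sieve.CoprimeSquarefreeSums
import Literature.NumberTheory.Sieve.SquarefreeIdealSums
import HarnessLib

/-!
# One-dimensional sieve sums over `𝓞_K`: `∑_{N𝔲 ≤ x, (𝔲,𝔴)=1} μ²(𝔲) ∏_{𝔭∣𝔲}(1 + c_𝔭)/N𝔲`

Topic `Literature/NumberTheory/Sieve`. The number-field analogue of the tree's
`Sieve/CoprimeSquarefreeSums.lean` (`SquarefreeSums.abs_sum_wfun_div_sub_le` over `ℤ`), i.e. the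
main-term engine of the one-dimensional sieve sums in the Maynard–Tao sieve over `𝓞_K`
(A. Castillo, C. Hall, R. J. Lemke Oliver, P. Pollack, L. Thompson, *Bounded gaps between primes in
number fields and function fields*, Proc. AMS 143 (2015), arXiv:1403.5808, §2.2: "we have
`∑_{N𝔲 < R, (𝔲,𝔴)=1} μ²(𝔲)/φ(𝔲) ≪ φ(𝔴) log R/|𝔴|`" and the main terms of `S₁`, `S₂`).
Everything in this file is PROVED.

For a nonzero ideal `𝔴` and weights `c_P` on the prime ideals with `|c_P| ≤ C₀/NP`:
* `sieveBloc 𝔴 c` — the local data `b(P, j)` (`b(P,1) = −1`, `b(P,j≥2) = 0` at `P ∣ 𝔴`;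
  `b(P,1) = c_P`, `b(P,2) = −(1+c_P)`, `b(P,j≥3) = 0` at `P ∤ 𝔴`), `sieveB = ppMul b` and the weight
  `sieveW 𝔴 c 𝔲 = 1_{(𝔲,𝔴)=1} μ²(𝔲) ∏_{P∣𝔲}(1 + c_P)`;
* `sum_divisors_sieveB` — **`∑_{𝔡∣𝔲} B(𝔡) = W(𝔲)`** (from `sum_divisors_ppMul`);
* `sum_abs_sieveB_mul_rpow_le` — the Euler-product majorant
  `∑_{N𝔡 ≤ x} |B(𝔡)| N𝔡^{-3/4} ≤ 2^{ω(𝔴)} exp((1+2C₀) ∑_{NP ≤ x} NP^{-3/2})`;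
* **`abs_sum_sieveW_div_sub_le`** — `|∑_{0<N𝔲≤x} W(𝔲)/N𝔲 − ρ_K β(x) log x| ≤ (C_H + 4ρ_K)·(majorant)`
  with `β(x) = ∑_{0<N𝔡≤x} B(𝔡)/N𝔡` (`W = B ⋆ 1`, regroup `𝔲 = 𝔡𝔫'`, harmonic sum over ideals at
  `x/N𝔡`, `log N𝔡/N𝔡 ≤ 4N𝔡^{-3/4}`);
* `sieveB_eq_idealMoebius`, `abs_bsum_sub_dsum_le` — `B = μ` on the divisors of `𝔴`, and
  `|β(x) − ∑_{𝔢∣𝔴} μ(𝔢)/N𝔢| ≤ D₀^{-1/4}·(majorant)` when every prime of norm `≤ D₀` divides `𝔴`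
  and `x ≥ N𝔴`;
* **`abs_sum_sieveW_div_sub_dsum_le`** (general `c`) and the specialisations
  **`abs_sum_inv_totientIdeal_sub_le`** (`c_P = 1/(NP−1)`:
  `|∑_{N𝔲≤x,(𝔲,𝔴)=1,𝔲 sq-free} 1/φ(𝔲) − ρ_K (∑_{𝔢∣𝔴} μ(𝔢)/N𝔢) log x| ≤ C_K 2^{ω(𝔴)} (1 + D₀^{-1/4} log x)`,
  `φ(𝔲) = ∏_{P∣𝔲}(NP − 1)`, the number-field form of Maynard's (5.13)/(6.5)) and
  **`abs_sum_inv_gIdeal_sub_le`** (`c_P = 2/(NP−2)`, `g(𝔲) = ∏_{P∣𝔲}(NP−2)`, Maynard's (5.20)/(6.11));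
* `dsum_eq_prod_one_sub_inv` — `∑_{𝔢∣𝔴} μ(𝔢)/N𝔢 = ∏_{P∣𝔴}(1 − 1/NP)` (`= φ(𝔴)/N𝔴`);
* `sum_inv_prod_sub_sq_le` — the tails `∑_{(𝔲,𝔴)=1, 𝔲≠(1)} μ²(𝔲)/∏_{P∣𝔲}(NP−k)² ≪_k D₀^{-1/2}`
  (Maynard's (5.19), (6.12); via `SquarefreeIdeal.sum_le_prod_one_add`).

## References

* A. Castillo, C. Hall, R. J. Lemke Oliver, P. Pollack, L. Thompson, arXiv:1403.5808, §2.2.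
  [cite: CastilloEtAl2015, §2.2]
* H. Halberstam, H.-E. Richert, *Sieve Methods* (1974), Ch. 3, (3.1.11) (the prototype over `ℤ`).
  [folklore]
-/

noncomputable section

open Finset
open scoped NumberField Classical


namespace Literature.NumberTheory.Sieve.IdealSieve

open UniqueFactorizationMonoid Literature.NumberTheory.LFunctions
  Literature.NumberTheory.LFunctions.NumberField

variable {K : Type*} [Field K] [NumberField K]

/-! ### Coprimality and prime factors -/

/-- For nonzero `𝔲`: `𝔲 + 𝔴 = (1)` iff no prime factor of `𝔲` divides `𝔴`. [folklore] -/
theorem sup_eq_top_iff_forall_not_dvd {𝔲 𝔴 : Ideal (𝓞 K)} (h𝔲 : 𝔲 ≠ ⊥) :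
    𝔲 ⊔ 𝔴 = ⊤ ↔ ∀ P ∈ normalizedFactors 𝔲, ¬ P ∣ 𝔴 := by
  have h𝔲0 : (𝔲 : Ideal (𝓞 K)) ≠ 0 := by rwa [Ne, Ideal.zero_eq_bot]
  constructor
  · intro h P hP hPw
    have hPp := prime_of_normalized_factor P hP
    have hPu : P ∣ 𝔲 := dvd_of_mem_normalizedFactors hP
    have : P ∣ 𝔲 ⊔ 𝔴 := (Ideal.dvd_iff_le).2 (sup_le (Ideal.dvd_iff_le.1 hPu) (Ideal.dvd_iff_le.1 hPw))
    rw [h, ← Ideal.one_eq_top, ← isUnit_iff_dvd_one, Ideal.isUnit_iff] at this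
    exact hPp.ne_one (by rw [this, Ideal.one_eq_top])
  · intro h
    by_contra hne
    obtain ⟨M, hM, hle⟩ := Ideal.exists_le_maximal _ hne
    have hMu : M ∣ 𝔲 := Ideal.dvd_iff_le.2 (le_sup_left.trans hle)
    have hMw : M ∣ 𝔴 := Ideal.dvd_iff_le.2 (le_sup_right.trans hle)
    have hMirr : Irreducible M := (Ideal.prime_of_isPrime (fun h0 => h𝔲 (le_bot_iff.1 (h0 ▸ le_sup_left.trans hle)))
      hM.isPrime).irreducible
    obtain ⟨Q, hQ, hMQ⟩ := exists_mem_normalizedFactors_of_dvd h𝔲0 hMirr hMu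
    rw [associated_iff_eq] at hMQ
    exact h Q hQ (hMQ ▸ hMw)

/-! ### The sieve weights: `b` on prime powers, `B = ppMul b`, and `W = ∑_{𝔡∣𝔲} B(𝔡)` -/

variable (𝔴 : Ideal (𝓞 K)) (c : Ideal (𝓞 K) → ℝ)

/-- The local data of the sieve weight: at `P ∣ 𝔴`, `b(P,1) = −1`, `b(P, j≥2) = 0`; at `P ∤ 𝔴`,
`b(P,1) = c_P`, `b(P,2) = −(1 + c_P)`, `b(P, j≥3) = 0` (so that `∑_{j ≤ v} b₀(P,j)` vanishes for
`v ≥ 1` at `P ∣ 𝔴` and for `v ≥ 2` at `P ∤ 𝔴`). [folklore] -/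
def sieveBloc (P : Ideal (𝓞 K)) (j : ℕ) : ℝ :=
  if P ∣ 𝔴 then (if j = 1 then -1 else 0)
  else (if j = 1 then c P else if j = 2 then -(1 + c P) else 0)

/-- The sieve function `B = ppMul b`. [folklore] -/
def sieveB : Ideal (𝓞 K) → ℝ := ppMul (sieveBloc 𝔴 c)

/-- The weight `W(𝔲) = 1_{(𝔲,𝔴)=1} μ²(𝔲) ∏_{P∣𝔲} (1 + c_P)`. [folklore] -/
def sieveW (𝔲 : Ideal (𝓞 K)) : ℝ :=
  if 𝔲 ⊔ 𝔴 = ⊤ ∧ Squarefree 𝔲 then ∏ P ∈ (normalizedFactors 𝔲).toFinset, (1 + c P) else 0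

omit [NumberField K] in
/-- The local divisor sums of `b`. [folklore] -/
theorem sum_range_sieveBloc (P : Ideal (𝓞 K)) {v : ℕ} (hv : 1 ≤ v) :
    ∑ j ∈ Finset.range (v + 1), (if j = 0 then (1 : ℝ) else sieveBloc 𝔴 c P j) =
      if P ∣ 𝔴 then 0 else (if v = 1 then 1 + c P else 0) := by
  -- split off `j = 0, 1, 2`; all further terms vanish
  have hrest : ∀ j, 3 ≤ j → sieveBloc 𝔴 c P j = 0 := by
    intro j hj
    simp only [sieveBloc]
    split_ifs <;> first | rfl | omega
  rcases Nat.lt_or_ge v 2 with hv2 | hv2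
  · have hv1 : v = 1 := by omega
    subst hv1
    simp only [Finset.sum_range_succ, Finset.sum_range_zero, zero_add, if_true, one_ne_zero, if_false,
      sieveBloc]
    split_ifs <;> ring
  · -- `v ≥ 2`
    have hsplit : ∑ j ∈ Finset.range (v + 1), (if j = 0 then (1 : ℝ) else sieveBloc 𝔴 c P j) =
        ∑ j ∈ Finset.range 3, (if j = 0 then (1 : ℝ) else sieveBloc 𝔴 c P j) := by
      rw [← Finset.sum_range_add_sum_Ico _ (by omega : 3 ≤ v + 1)]
      rw [Finset.sum_eq_zero (s := Finset.Ico 3 (v + 1)) fun j hj => by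
        rw [if_neg (by have := (Finset.mem_Ico.1 hj).1; omega), hrest j (Finset.mem_Ico.1 hj).1]]
      ring
    rw [hsplit]
    simp only [Finset.sum_range_succ, Finset.sum_range_zero, zero_add, if_true, one_ne_zero, if_false,
      sieveBloc, show (2 : ℕ) ≠ 0 from two_ne_zero, show (2 : ℕ) ≠ 1 from by norm_num]
    have hv1 : v ≠ 1 := by omega
    split_ifs <;> ring

omit [NumberField K] in
/-- `b(P, j) = 0` for `j ≥ 3`. [folklore] -/
theorem sieveBloc_eq_zero_of_three_le (P : Ideal (𝓞 K)) {j : ℕ} (hj : 3 ≤ j) :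
    sieveBloc 𝔴 c P j = 0 := by
  simp only [sieveBloc]
  split_ifs <;> first | rfl | omega

omit [NumberField K] in
/-- The values `b(P,1), b(P,2)`. [folklore] -/
theorem sieveBloc_one_two (P : Ideal (𝓞 K)) :
    sieveBloc 𝔴 c P 1 = (if P ∣ 𝔴 then -1 else c P) ∧
      sieveBloc 𝔴 c P 2 = (if P ∣ 𝔴 then 0 else -(1 + c P)) := by
  simp only [sieveBloc]
  split_ifs <;> first | exact ⟨rfl, rfl⟩ | omega

/-- **`∑_{𝔡 ∣ 𝔲} B(𝔡) = W(𝔲)`** for `𝔲 ≠ 0` (`D` the divisors of `𝔲`). [folklore] -/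
theorem sum_divisors_sieveB {𝔲 : Ideal (𝓞 K)} (h𝔲 : 𝔲 ≠ ⊥) {D : Finset (Ideal (𝓞 K))}
    (hD : ∀ 𝔡, 𝔡 ∈ D ↔ 𝔡 ∣ 𝔲) : ∑ 𝔡 ∈ D, sieveB 𝔴 c 𝔡 = sieveW 𝔴 c 𝔲 := by
  have h𝔲0 : (𝔲 : Ideal (𝓞 K)) ≠ 0 := by rwa [Ne, Ideal.zero_eq_bot]
  rw [sieveB, sum_divisors_ppMul _ h𝔲 hD]
  have hcount : ∀ P ∈ (normalizedFactors 𝔲).toFinset, 1 ≤ Multiset.count P (normalizedFactors 𝔲) :=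
    fun P hP => Multiset.one_le_count_iff_mem.2 (Multiset.mem_toFinset.1 hP)
  rw [Finset.prod_congr rfl fun P hP => sum_range_sieveBloc 𝔴 c P (hcount P hP), sieveW]
  by_cases hcop : 𝔲 ⊔ 𝔴 = ⊤
  · have hno := (sup_eq_top_iff_forall_not_dvd h𝔲).1 hcop
    rw [Finset.prod_congr rfl fun P hP => if_neg (hno P (Multiset.mem_toFinset.1 hP))]
    by_cases hsq : Squarefree 𝔲
    · rw [if_pos ⟨hcop, hsq⟩]
      refine Finset.prod_congr rfl fun P hP => ?_
      have h1 : Multiset.count P (normalizedFactors 𝔲) = 1 := by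
        have hle := Multiset.nodup_iff_count_le_one.1
          ((squarefree_iff_nodup_normalizedFactors h𝔲0).1 hsq) P
        have hge := hcount P hP
        omega
      rw [if_pos h1]
    · rw [if_neg (fun h => hsq h.2)]
      -- some prime has multiplicity `≥ 2`
      have : ∃ P ∈ (normalizedFactors 𝔲).toFinset, Multiset.count P (normalizedFactors 𝔲) ≠ 1 := by
        by_contra hall
        push Not at hall
        refine hsq ((squarefree_iff_nodup_normalizedFactors h𝔲0).2 ?_)
        rw [Multiset.nodup_iff_count_le_one]
        intro P
        by_cases hP : P ∈ (normalizedFactors 𝔲).toFinset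
        · rw [hall P hP]
        · rw [Multiset.mem_toFinset] at hP
          rw [Multiset.count_eq_zero_of_notMem hP]; omega
      obtain ⟨P, hP, hne⟩ := this
      exact Finset.prod_eq_zero hP (if_neg hne)
  · rw [if_neg (fun h => hcop h.1)]
    have : ∃ P ∈ (normalizedFactors 𝔲).toFinset, P ∣ 𝔴 := by
      by_contra hall
      push Not at hall
      exact hcop ((sup_eq_top_iff_forall_not_dvd h𝔲).2 fun P hP => hall P (Multiset.mem_toFinset.2 hP))
    obtain ⟨P, hP, hPw⟩ := this
    exact Finset.prod_eq_zero hP (if_pos hPw)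

/-! ### The Euler-product majorant `∑_{N𝔡 ≤ x} |B(𝔡)| N𝔡^{-3/4} ≤ 2^{ω(𝔴)} exp((1+2C₀) ∑_P NP^{-3/2})` -/

/-- `N𝔡 = ∏_{P ∣ 𝔡} NP^{v_P(𝔡)}` (real, `𝔡 ≠ 0`). [folklore] -/
theorem absNorm_eq_prod_pow {𝔡 : Ideal (𝓞 K)} (h𝔡 : 𝔡 ≠ ⊥) :
    ((Ideal.absNorm 𝔡 : ℕ) : ℝ) =
      ∏ P ∈ (normalizedFactors 𝔡).toFinset,
        ((Ideal.absNorm P : ℕ) : ℝ) ^ Multiset.count P (normalizedFactors 𝔡) := by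
  have h𝔡0 : (𝔡 : Ideal (𝓞 K)) ≠ 0 := by rwa [Ne, Ideal.zero_eq_bot]
  conv_lhs => rw [← associated_iff_eq.1 (prod_normalizedFactors h𝔡0)]
  rw [map_multiset_prod, Finset.prod_multiset_map_count]
  push_cast
  rfl

/-- The `ppMul` form of `|B(𝔡)| N𝔡^{-3/4}`. [folklore] -/
theorem abs_sieveB_mul_rpow_eq {𝔡 : Ideal (𝓞 K)} (h𝔡 : 𝔡 ≠ ⊥) :
    |sieveB 𝔴 c 𝔡| * ((Ideal.absNorm 𝔡 : ℕ) : ℝ) ^ (-(3 : ℝ) / 4) =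
      ppMul (fun P j => |sieveBloc 𝔴 c P j| * ((Ideal.absNorm P : ℕ) : ℝ) ^ (-(3 : ℝ) / 4 * j)) 𝔡 := by
  rw [sieveB, ppMul, ppMul, Finset.abs_prod, absNorm_eq_prod_pow h𝔡,
    ← Real.finsetProd_rpow _ _ (fun P _ => by positivity), ← Finset.prod_mul_distrib]
  refine Finset.prod_congr rfl fun P _ => ?_
  rw [← Real.rpow_natCast, ← Real.rpow_mul (Nat.cast_nonneg _), mul_comm (Multiset.count P _ : ℝ)]

/-- `ppMul g 𝔡 ≥ 0` for `g ≥ 0`. [folklore] -/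
theorem ppMul_nonneg {g : Ideal (𝓞 K) → ℕ → ℝ} (hg : ∀ P j, 0 ≤ g P j) (𝔡 : Ideal (𝓞 K)) :
    0 ≤ ppMul g 𝔡 := Finset.prod_nonneg fun P _ => hg P _

/-- The square of the product of a finite set of primes: factorization. [folklore] -/
theorem normalizedFactors_prod_sq {T : Finset (Ideal (𝓞 K))} (hT : ∀ P ∈ T, Prime P) :
    normalizedFactors (∏ P ∈ T, P ^ 2) = T.val.bind fun P => Multiset.replicate 2 P := by
  have h : (∏ P ∈ T, P ^ 2) = (T.val.bind fun P => Multiset.replicate 2 P).prod := by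
    rw [Multiset.prod_bind, Finset.prod_eq_multiset_prod]
    congr 1
    exact Multiset.map_congr rfl fun P _ => (Multiset.prod_replicate 2 P).symm
  rw [h]
  refine normalizedFactors_prod_of_prime fun Q hQ => ?_
  obtain ⟨P, hP, hQP⟩ := Multiset.mem_bind.1 hQ
  rw [Multiset.eq_of_mem_replicate hQP]
  exact hT P hP

omit [NumberField K] in
/-- Multiplicities in `T.val.bind (replicate 2)`. [folklore] -/
theorem count_bind_replicate_two (T : Finset (Ideal (𝓞 K))) (Q : Ideal (𝓞 K)) :
    Multiset.count Q (T.val.bind fun P => Multiset.replicate 2 P) = if Q ∈ T then 2 else 0 := by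
  rw [Multiset.count_bind, ← Finset.sum_eq_multiset_sum]
  simp only [Multiset.count_replicate]
  rw [Finset.sum_ite_eq']

/-- **The Euler-product majorant for `B`**: with `T` the nonzero primes of norm `≤ x` and
`|c_P| ≤ C₀/NP` (`C₀ ≥ 0`),
`∑_{0 < N𝔡 ≤ x} |B(𝔡)| N𝔡^{-3/4} ≤ 2^{ω(𝔴)} · exp((1 + 2C₀) ∑_{P ∈ T} NP^{-3/2})` (the sum is at
most the divisor sum of the multiplicative `|B| N^{-3/4}` over `∏_{P ∈ T} P²`, which factors by
`sum_divisors_ppMul`). [folklore] -/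
theorem sum_abs_sieveB_mul_rpow_le {C₀ : ℝ} (hC₀ : 0 ≤ C₀)
    (hc : ∀ P : Ideal (𝓞 K), Prime P → |c P| ≤ C₀ / Ideal.absNorm P) (h𝔴 : 𝔴 ≠ ⊥) (x : ℝ) :
    ∑ 𝔡 ∈ idealsLE K x, |sieveB 𝔴 c 𝔡| * ((Ideal.absNorm 𝔡 : ℕ) : ℝ) ^ (-(3 : ℝ) / 4) ≤
      2 ^ (normalizedFactors 𝔴).toFinset.card *
        Real.exp ((1 + 2 * C₀) * ∑ P ∈ (finite_primeIdealsLE K x).toFinset,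
          ((Ideal.absNorm P : ℕ) : ℝ) ^ (-(3 : ℝ) / 2)) := by
  set g : Ideal (𝓞 K) → ℕ → ℝ := fun P j =>
    |sieveBloc 𝔴 c P j| * ((Ideal.absNorm P : ℕ) : ℝ) ^ (-(3 : ℝ) / 4 * j) with hg
  have hg0 : ∀ P j, 0 ≤ g P j := fun P j => by positivity
  set T := (finite_primeIdealsLE K x).toFinset with hT
  have hTprime : ∀ P ∈ T, Prime P := by
    intro P hP
    rw [hT, Set.Finite.mem_toFinset] at hP
    exact Ideal.prime_of_isPrime hP.2.1 hP.1
  set 𝔐 : Ideal (𝓞 K) := ∏ P ∈ T, P ^ 2 with h𝔐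
  have h𝔐0 : 𝔐 ≠ ⊥ := by
    rw [h𝔐, Ne, ← Ideal.zero_eq_bot, Finset.prod_eq_zero_iff]
    rintro ⟨P, hP, h0⟩
    exact (hTprime P hP).ne_zero (pow_eq_zero_iff two_ne_zero |>.1 h0)
  have hnf𝔐 := normalizedFactors_prod_sq hTprime
  have hcount𝔐 : ∀ Q, Multiset.count Q (normalizedFactors 𝔐) = if Q ∈ T then 2 else 0 := fun Q => by
    rw [hnf𝔐, count_bind_replicate_two]
  have htf𝔐 : (normalizedFactors 𝔐).toFinset = T := by
    ext Q
    rw [Multiset.mem_toFinset, ← Multiset.one_le_count_iff_mem, hcount𝔐]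
    split_ifs with h <;> simp [h]
  -- Step 1: rewrite the summand as `ppMul g`, drop the ideals with a cube factor, pass to divisors of `𝔐`
  have hstep1 : ∑ 𝔡 ∈ idealsLE K x, |sieveB 𝔴 c 𝔡| * ((Ideal.absNorm 𝔡 : ℕ) : ℝ) ^ (-(3 : ℝ) / 4) ≤
      ∑ 𝔡 ∈ idealDivisors K 𝔐, ppMul g 𝔡 := by
    have heq : ∑ 𝔡 ∈ idealsLE K x, |sieveB 𝔴 c 𝔡| * ((Ideal.absNorm 𝔡 : ℕ) : ℝ) ^ (-(3 : ℝ) / 4) =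
        ∑ 𝔡 ∈ idealsLE K x, ppMul g 𝔡 :=
      Finset.sum_congr rfl fun 𝔡 h𝔡 => abs_sieveB_mul_rpow_eq 𝔴 c (mem_idealsLE.1 h𝔡).1
    rw [heq]
    -- ideals with some multiplicity `≥ 3` contribute `0`
    have hzero : ∀ 𝔡 ∈ idealsLE K x, 𝔡 ∉ idealDivisors K 𝔐 → ppMul g 𝔡 = 0 := by
      intro 𝔡 h𝔡 hnot
      have h𝔡0 := (mem_idealsLE.1 h𝔡).1
      have h𝔡0' : (𝔡 : Ideal (𝓞 K)) ≠ 0 := by rwa [Ne, Ideal.zero_eq_bot]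
      -- if all multiplicities were `≤ 2`, `𝔡` would divide `𝔐`
      by_contra hne
      refine hnot ((mem_idealDivisors h𝔐0).2 ?_)
      rw [dvd_iff_normalizedFactors_le_normalizedFactors h𝔡0' (by rwa [Ne, Ideal.zero_eq_bot]),
        Multiset.le_iff_count]
      intro Q
      rw [hcount𝔐]
      by_cases hQ : Q ∈ normalizedFactors 𝔡
      · have hQT : Q ∈ T := by
          rw [hT, Set.Finite.mem_toFinset]
          have hQp := prime_of_normalized_factor Q hQ
          refine ⟨Ideal.isPrime_of_prime hQp, hQp.ne_zero, ?_⟩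
          have hdvd : Ideal.absNorm Q ∣ Ideal.absNorm 𝔡 := map_dvd _ (dvd_of_mem_normalizedFactors hQ)
          have hN𝔡 : Ideal.absNorm 𝔡 ≠ 0 := by rwa [Ne, Ideal.absNorm_eq_zero_iff]
          calc (Ideal.absNorm Q : ℝ) ≤ Ideal.absNorm 𝔡 := by
                exact_mod_cast Nat.le_of_dvd (Nat.pos_of_ne_zero hN𝔡) hdvd
            _ ≤ x := (mem_idealsLE.1 h𝔡).2
        rw [if_pos hQT]
        -- multiplicity `≥ 3` would kill `ppMul g 𝔡`
        by_contra hlt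
        refine hne (Finset.prod_eq_zero (Multiset.mem_toFinset.2 hQ) ?_)
        have h3 : 3 ≤ Multiset.count Q (normalizedFactors 𝔡) := by omega
        simp only [hg, sieveBloc_eq_zero_of_three_le 𝔴 c Q h3, abs_zero, zero_mul]
      · rw [Multiset.count_eq_zero_of_notMem hQ]; exact Nat.zero_le _
    calc ∑ 𝔡 ∈ idealsLE K x, ppMul g 𝔡
        = ∑ 𝔡 ∈ (idealsLE K x).filter (· ∈ idealDivisors K 𝔐), ppMul g 𝔡 := by
          rw [Finset.sum_filter]
          refine Finset.sum_congr rfl fun 𝔡 h𝔡 => ?_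
          split_ifs with h
          · rfl
          · exact hzero 𝔡 h𝔡 h
      _ ≤ ∑ 𝔡 ∈ idealDivisors K 𝔐, ppMul g 𝔡 :=
          Finset.sum_le_sum_of_subset_of_nonneg (fun 𝔡 h => (Finset.mem_filter.1 h).2)
            fun 𝔡 _ _ => ppMul_nonneg hg0 𝔡
  -- Step 2: factor the divisor sum and bound the local factors
  refine hstep1.trans ?_
  rw [sum_divisors_ppMul g h𝔐0 (fun 𝔡 => mem_idealDivisors h𝔐0), htf𝔐]
  have hlocal : ∀ P ∈ T, ∑ j ∈ Finset.range (Multiset.count P (normalizedFactors 𝔐) + 1),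
      (if j = 0 then (1 : ℝ) else g P j) ≤
      (if P ∣ 𝔴 then 2 else 1) * Real.exp ((1 + 2 * C₀) * ((Ideal.absNorm P : ℕ) : ℝ) ^ (-(3 : ℝ) / 2)) := by
    intro P hP
    have hPp := hTprime P hP
    rw [hcount𝔐, if_pos hP]
    have hsum : ∑ j ∈ Finset.range (2 + 1), (if j = 0 then (1 : ℝ) else g P j) = 1 + g P 1 + g P 2 := by
      simp [Finset.sum_range_succ]
    rw [hsum]
    have hN2 : (2 : ℝ) ≤ ((Ideal.absNorm P : ℕ) : ℝ) := by exact_mod_cast two_le_absNorm_of_prime hPp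
    have hN0 : (0 : ℝ) < ((Ideal.absNorm P : ℕ) : ℝ) := by linarith
    have hg1 : g P 1 = |sieveBloc 𝔴 c P 1| * ((Ideal.absNorm P : ℕ) : ℝ) ^ (-(3 : ℝ) / 4) := by
      simp only [hg, Nat.cast_one, mul_one]
    have hg2 : g P 2 = |sieveBloc 𝔴 c P 2| * ((Ideal.absNorm P : ℕ) : ℝ) ^ (-(3 : ℝ) / 2) := by
      simp only [hg, Nat.cast_ofNat]
      norm_num
    obtain ⟨hb1, hb2⟩ := sieveBloc_one_two 𝔴 c P
    have hexp0 : 1 ≤ Real.exp ((1 + 2 * C₀) * ((Ideal.absNorm P : ℕ) : ℝ) ^ (-(3 : ℝ) / 2)) :=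
      Real.one_le_exp (by positivity)
    have hr34 : ((Ideal.absNorm P : ℕ) : ℝ) ^ (-(3 : ℝ) / 4) ≤ 1 :=
      Real.rpow_le_one_of_one_le_of_nonpos (by linarith) (by norm_num)
    have hrpow0 : 0 ≤ ((Ideal.absNorm P : ℕ) : ℝ) ^ (-(3 : ℝ) / 2) := by positivity
    by_cases hPw : P ∣ 𝔴
    · rw [if_pos hPw, hg1, hg2, hb1, hb2, if_pos hPw, if_pos hPw, abs_neg, abs_one, one_mul, abs_zero,
        zero_mul, add_zero]
      nlinarith
    · rw [if_neg hPw, one_mul, hg1, hg2, hb1, hb2, if_neg hPw, if_neg hPw, abs_neg]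
      have hcP := hc P hPp
      have hcP' : |c P| ≤ C₀ := hcP.trans (div_le_self hC₀ (by linarith))
      have h1c : |1 + c P| ≤ 1 + C₀ := (abs_add_le _ _).trans (by rw [abs_one]; linarith)
      have hA : |c P| * ((Ideal.absNorm P : ℕ) : ℝ) ^ (-(3 : ℝ) / 4) ≤
          C₀ * ((Ideal.absNorm P : ℕ) : ℝ) ^ (-(3 : ℝ) / 2) := by
        -- `|c_P| N^{-3/4} ≤ (C₀/N) N^{-3/4} = C₀ N^{-7/4} ≤ C₀ N^{-3/2}`
        calc |c P| * ((Ideal.absNorm P : ℕ) : ℝ) ^ (-(3 : ℝ) / 4)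
            ≤ C₀ / ((Ideal.absNorm P : ℕ) : ℝ) * ((Ideal.absNorm P : ℕ) : ℝ) ^ (-(3 : ℝ) / 4) :=
              mul_le_mul_of_nonneg_right hcP (by positivity)
          _ = C₀ * ((Ideal.absNorm P : ℕ) : ℝ) ^ (-(7 : ℝ) / 4) := by
              rw [div_eq_mul_inv, ← Real.rpow_neg_one, mul_assoc, ← Real.rpow_add hN0]
              norm_num
          _ ≤ C₀ * ((Ideal.absNorm P : ℕ) : ℝ) ^ (-(3 : ℝ) / 2) := by
              refine mul_le_mul_of_nonneg_left ?_ hC₀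
              exact Real.rpow_le_rpow_of_exponent_le (by linarith) (by norm_num)
      have hB : |1 + c P| * ((Ideal.absNorm P : ℕ) : ℝ) ^ (-(3 : ℝ) / 2) ≤
          (1 + C₀) * ((Ideal.absNorm P : ℕ) : ℝ) ^ (-(3 : ℝ) / 2) :=
        mul_le_mul_of_nonneg_right h1c hrpow0
      have hE := Real.add_one_le_exp ((1 + 2 * C₀) * ((Ideal.absNorm P : ℕ) : ℝ) ^ (-(3 : ℝ) / 2))
      nlinarith
  have hnonneg : ∀ P ∈ T, 0 ≤ ∑ j ∈ Finset.range (Multiset.count P (normalizedFactors 𝔐) + 1),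
      (if j = 0 then (1 : ℝ) else g P j) := fun P _ =>
    Finset.sum_nonneg fun j _ => by split_ifs <;> first | exact zero_le_one | exact hg0 _ _
  refine (Finset.prod_le_prod hnonneg hlocal).trans ?_
  rw [Finset.prod_mul_distrib, ← Real.exp_sum, ← Finset.mul_sum]
  refine mul_le_mul_of_nonneg_right ?_ (Real.exp_pos _).le
  -- `∏_{P ∈ T} (2 if P ∣ 𝔴 else 1) ≤ 2^{ω(𝔴)}`
  rw [Finset.prod_ite, Finset.prod_const_one, mul_one, Finset.prod_const]
  refine pow_le_pow_right₀ (by norm_num) ?_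
  refine Finset.card_le_card_of_injOn id (fun P hP => ?_) (Set.injOn_id _)
  rw [Finset.mem_coe, Finset.mem_filter] at hP
  rw [Finset.mem_coe, Multiset.mem_toFinset]
  have h𝔴0 : (𝔴 : Ideal (𝓞 K)) ≠ 0 := by rwa [Ne, Ideal.zero_eq_bot]
  obtain ⟨Q, hQ, hPQ⟩ := exists_mem_normalizedFactors_of_dvd h𝔴0 (hTprime P hP.1).irreducible hP.2
  rwa [associated_iff_eq.1 hPQ]

/-! ### The main estimate `∑_{N𝔲 ≤ x} W(𝔲)/N𝔲 = ρ_K β(x) log x + O_{𝔴,C₀}(1)` -/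

/-- **One-dimensional sieve sum over `𝓞_K`** (the analogue of
`Literature.NumberTheory.Sieve.SquarefreeSums.abs_sum_wfun_div_sub_le`): for `𝔴 ≠ 0`,
`|c_P| ≤ C₀/NP` and `x ≥ 1`,
`|∑_{0<N𝔲≤x} W(𝔲)/N𝔲 − ρ_K β(x) log x| ≤ (C_H + 4ρ_K) · 2^{ω(𝔴)} exp((1+2C₀)∑_{P} NP^{-3/2})`,
where `W(𝔲) = 1_{(𝔲,𝔴)=1} μ²(𝔲) ∏_{P∣𝔲}(1 + c_P)`, `β(x) = ∑_{0<N𝔡≤x} B(𝔡)/N𝔡`, `C_H` the constant of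
`abs_harmonic_sub_log_le` and the sum over the primes of norm `≤ x`
(`W = B ⋆ 1`, regroup `𝔲 = 𝔡𝔫'`, harmonic sum at `x/N𝔡`, `log N𝔡/N𝔡 ≤ 4 N𝔡^{-3/4}`).
[cite: CastilloEtAl2015, §2.2 (the sums ∑_{(𝔲,𝔴)=1} μ²(𝔲)/φ(𝔲) ≪ φ(𝔴) log R/|𝔴|)] -/
theorem abs_sum_sieveW_div_sub_le :
    ∃ C_H : ℝ, ∀ (𝔴 : Ideal (𝓞 K)), 𝔴 ≠ ⊥ → ∀ (c : Ideal (𝓞 K) → ℝ) (C₀ : ℝ), 0 ≤ C₀ →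
      (∀ P : Ideal (𝓞 K), Prime P → |c P| ≤ C₀ / Ideal.absNorm P) → ∀ x : ℝ, 1 ≤ x →
      |∑ 𝔲 ∈ idealsLE K x, sieveW 𝔴 c 𝔲 / ((Ideal.absNorm 𝔲 : ℕ) : ℝ) -
          NumberField.dedekindZeta_residue K *
            (∑ 𝔡 ∈ idealsLE K x, sieveB 𝔴 c 𝔡 / ((Ideal.absNorm 𝔡 : ℕ) : ℝ)) * Real.log x| ≤
        (C_H + 4 * NumberField.dedekindZeta_residue K) *
          (2 ^ (normalizedFactors 𝔴).toFinset.card *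
            Real.exp ((1 + 2 * C₀) * ∑ P ∈ (finite_primeIdealsLE K x).toFinset,
              ((Ideal.absNorm P : ℕ) : ℝ) ^ (-(3 : ℝ) / 2))) := by
  obtain ⟨C_H, hCH⟩ := abs_harmonic_sub_log_le K
  set ρ : ℝ := NumberField.dedekindZeta_residue K with hρ
  have hρ0 : 0 < ρ := NumberField.dedekindZeta_residue_pos K
  have hCH0 : 0 ≤ C_H := (abs_nonneg _).trans (hCH 1 le_rfl)
  refine ⟨C_H, fun 𝔴 h𝔴 c C₀ hC₀ hc x hx => ?_⟩
  set A := idealsLE K x with hA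
  set BC : ℝ := 2 ^ (normalizedFactors 𝔴).toFinset.card *
    Real.exp ((1 + 2 * C₀) * ∑ P ∈ (finite_primeIdealsLE K x).toFinset,
      ((Ideal.absNorm P : ℕ) : ℝ) ^ (-(3 : ℝ) / 2)) with hBC
  have hmaj := sum_abs_sieveB_mul_rpow_le 𝔴 c hC₀ hc h𝔴 x
  -- Step 1: `W = ∑_{𝔡 ∣ 𝔲} B(𝔡)` with `𝔡` ranging in `A`
  have hstep1 : ∑ 𝔲 ∈ A, sieveW 𝔴 c 𝔲 / ((Ideal.absNorm 𝔲 : ℕ) : ℝ) =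
      ∑ 𝔲 ∈ A, ∑ 𝔡 ∈ A.filter (· ∣ 𝔲), sieveB 𝔴 c 𝔡 / ((Ideal.absNorm 𝔲 : ℕ) : ℝ) := by
    refine Finset.sum_congr rfl fun 𝔲 h𝔲 => ?_
    have h𝔲0 := (mem_idealsLE.1 h𝔲).1
    rw [← Finset.sum_div, sum_divisors_sieveB 𝔴 c h𝔲0]
    intro 𝔡
    rw [Finset.mem_filter, hA, mem_idealsLE]
    constructor
    · exact fun h => h.2
    · intro h
      have h𝔡0 : 𝔡 ≠ ⊥ := by
        rintro rfl; rw [Ideal.dvd_iff_le, le_bot_iff] at h; exact h𝔲0 h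
      refine ⟨⟨h𝔡0, le_trans ?_ (mem_idealsLE.1 h𝔲).2⟩, h⟩
      have hN𝔲 : Ideal.absNorm 𝔲 ≠ 0 := by rw [Ne, Ideal.absNorm_eq_zero_iff]; exact h𝔲0
      exact_mod_cast Nat.le_of_dvd (Nat.pos_of_ne_zero hN𝔲) (map_dvd _ h)
  -- Step 2: regroup
  have hD0 : ∀ 𝔡 ∈ A, 𝔡 ≠ ⊥ := fun 𝔡 h => (mem_idealsLE.1 h).1
  have hstep2 := sum_idealsLE_sum_filter_dvd_eq hD0
    (fun 𝔡 𝔲 => sieveB 𝔴 c 𝔡 / ((Ideal.absNorm 𝔲 : ℕ) : ℝ)) x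
  rw [hstep1, hstep2]
  -- Step 3: inner sums are `B(𝔡)/N𝔡 · H(x/N𝔡)`
  have hinner : ∀ 𝔡 ∈ A, ∑ 𝔫' ∈ idealsLE K (x / Ideal.absNorm 𝔡),
      sieveB 𝔴 c 𝔡 / ((Ideal.absNorm (𝔡 * 𝔫') : ℕ) : ℝ) =
      sieveB 𝔴 c 𝔡 / ((Ideal.absNorm 𝔡 : ℕ) : ℝ) *
        ∑ 𝔫' ∈ idealsLE K (x / Ideal.absNorm 𝔡), ((Ideal.absNorm 𝔫' : ℕ) : ℝ)⁻¹ := by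
    intro 𝔡 _
    rw [Finset.mul_sum]
    refine Finset.sum_congr rfl fun 𝔫' _ => ?_
    rw [map_mul, Nat.cast_mul, div_mul_eq_div_div, div_eq_mul_inv]
  rw [Finset.sum_congr rfl hinner, Finset.mul_sum, Finset.sum_mul, ← Finset.sum_sub_distrib]
  -- Step 4: termwise `|B/N𝔡 (H(x/N𝔡) − ρ log x)| ≤ |B|/N𝔡 (C_H + ρ log N𝔡) ≤ |B| N𝔡^{-3/4} (C_H + 4ρ)`
  have hterm : ∀ 𝔡 ∈ A,
      |sieveB 𝔴 c 𝔡 / ((Ideal.absNorm 𝔡 : ℕ) : ℝ) *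
          ∑ 𝔫' ∈ idealsLE K (x / Ideal.absNorm 𝔡), ((Ideal.absNorm 𝔫' : ℕ) : ℝ)⁻¹ -
        ρ * (sieveB 𝔴 c 𝔡 / ((Ideal.absNorm 𝔡 : ℕ) : ℝ)) * Real.log x| ≤
      (C_H + 4 * ρ) * (|sieveB 𝔴 c 𝔡| * ((Ideal.absNorm 𝔡 : ℕ) : ℝ) ^ (-(3 : ℝ) / 4)) := by
    intro 𝔡 h𝔡
    set N : ℝ := ((Ideal.absNorm 𝔡 : ℕ) : ℝ) with hN
    have hN1 : 1 ≤ N := one_le_absNorm_of_mem_idealsLE h𝔡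
    have hN0 : 0 < N := by linarith
    have hNx : N ≤ x := (mem_idealsLE.1 h𝔡).2
    have hz : 1 ≤ x / N := by rwa [le_div_iff₀ hN0, one_mul]
    set H : ℝ := ∑ 𝔫' ∈ idealsLE K (x / N), ((Ideal.absNorm 𝔫' : ℕ) : ℝ)⁻¹ with hH
    have hHb := hCH (x / N) hz
    rw [Real.log_div (by linarith) hN0.ne'] at hHb
    have hkey : |H - ρ * Real.log x| ≤ C_H + ρ * Real.log N := by
      have : H - ρ * Real.log x = (H - ρ * (Real.log x - Real.log N)) - ρ * Real.log N := by ring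
      rw [this]
      refine (abs_sub _ _).trans (add_le_add hHb ?_)
      rw [abs_of_nonneg (mul_nonneg hρ0.le (Real.log_nonneg hN1))]
    have hN1' : 1 ≤ Ideal.absNorm 𝔡 :=
      Nat.one_le_iff_ne_zero.2 (by rw [Ne, Ideal.absNorm_eq_zero_iff]; exact (mem_idealsLE.1 h𝔡).1)
    have hlog : Real.log N / N ≤ 4 * N ^ (-(3 : ℝ) / 4) :=
      Literature.NumberTheory.Sieve.SquarefreeSums.log_div_le_rpow_neg hN1'
    have hinv : 1 / N ≤ N ^ (-(3 : ℝ) / 4) :=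
      Literature.NumberTheory.Sieve.SquarefreeSums.inv_le_rpow_neg hN1'
    calc |sieveB 𝔴 c 𝔡 / N * H - ρ * (sieveB 𝔴 c 𝔡 / N) * Real.log x|
        = |sieveB 𝔴 c 𝔡| / N * |H - ρ * Real.log x| := by
          rw [show sieveB 𝔴 c 𝔡 / N * H - ρ * (sieveB 𝔴 c 𝔡 / N) * Real.log x =
              sieveB 𝔴 c 𝔡 / N * (H - ρ * Real.log x) by ring, abs_mul, abs_div, abs_of_pos hN0]
      _ ≤ |sieveB 𝔴 c 𝔡| / N * (C_H + ρ * Real.log N) :=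
          mul_le_mul_of_nonneg_left hkey (by positivity)
      _ = |sieveB 𝔴 c 𝔡| * (C_H * (1 / N) + ρ * (Real.log N / N)) := by ring
      _ ≤ |sieveB 𝔴 c 𝔡| * (C_H * N ^ (-(3 : ℝ) / 4) + ρ * (4 * N ^ (-(3 : ℝ) / 4))) := by
          refine mul_le_mul_of_nonneg_left (add_le_add ?_ ?_) (abs_nonneg _)
          · exact mul_le_mul_of_nonneg_left hinv hCH0
          · exact mul_le_mul_of_nonneg_left hlog hρ0.le
      _ = (C_H + 4 * ρ) * (|sieveB 𝔴 c 𝔡| * N ^ (-(3 : ℝ) / 4)) := by ring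
  refine (Finset.abs_sum_le_sum_abs _ _).trans ((Finset.sum_le_sum hterm).trans ?_)
  rw [← Finset.mul_sum]
  exact mul_le_mul_of_nonneg_left hmaj (by positivity)

/-! ### Specialisation `c_P = 1/(NP − 1)`: `∑_{N𝔲 ≤ x, (𝔲,𝔴)=1} μ²(𝔲)/φ(𝔲)` -/

/-- On the ideals all of whose prime factors divide `𝔴`, `B = μ`. [folklore] -/
theorem sieveB_eq_idealMoebius {𝔡 : Ideal (𝓞 K)} (h𝔡 : 𝔡 ≠ ⊥)
    (hall : ∀ P ∈ normalizedFactors 𝔡, P ∣ 𝔴) : sieveB 𝔴 c 𝔡 = idealMoebius 𝔡 := by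
  have h𝔡0 : (𝔡 : Ideal (𝓞 K)) ≠ 0 := by rwa [Ne, Ideal.zero_eq_bot]
  rw [sieveB, ppMul]
  by_cases hsq : Squarefree 𝔡
  · have hnd := (squarefree_iff_nodup_normalizedFactors h𝔡0).1 hsq
    rw [idealMoebius_apply_of_squarefree hsq, ← Multiset.toFinset_card_of_nodup hnd]
    push_cast
    rw [← Finset.prod_const]
    refine Finset.prod_congr rfl fun P hP => ?_
    have hP' := Multiset.mem_toFinset.1 hP
    have h1 : Multiset.count P (normalizedFactors 𝔡) = 1 := by
      have := Multiset.nodup_iff_count_le_one.1 hnd P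
      have := Multiset.one_le_count_iff_mem.2 hP'
      omega
    rw [h1, (sieveBloc_one_two 𝔴 c P).1, if_pos (hall P hP')]
  · rw [idealMoebius_apply_of_not_squarefree hsq, Int.cast_zero]
    have : ∃ P ∈ (normalizedFactors 𝔡).toFinset, 2 ≤ Multiset.count P (normalizedFactors 𝔡) := by
      by_contra hno
      push Not at hno
      refine hsq ((squarefree_iff_nodup_normalizedFactors h𝔡0).2 ?_)
      rw [Multiset.nodup_iff_count_le_one]
      intro P
      by_cases hP : P ∈ (normalizedFactors 𝔡).toFinset
      · have := hno P hP; omega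
      · rw [Multiset.mem_toFinset] at hP
        rw [Multiset.count_eq_zero_of_notMem hP]; omega
    obtain ⟨P, hP, h2⟩ := this
    refine Finset.prod_eq_zero hP ?_
    have hPw := hall P (Multiset.mem_toFinset.1 hP)
    simp only [sieveBloc, if_pos hPw]
    rw [if_neg (by omega)]

/-- If `B(𝔡) ≠ 0` and `𝔡 ∤ 𝔴` then some prime factor of `𝔡` does not divide `𝔴`. [folklore] -/
theorem exists_factor_not_dvd_of_sieveB_ne_zero {𝔡 : Ideal (𝓞 K)} (h𝔡 : 𝔡 ≠ ⊥) (h𝔴 : 𝔴 ≠ ⊥)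
    (hB : sieveB 𝔴 c 𝔡 ≠ 0) (hnd : ¬ 𝔡 ∣ 𝔴) : ∃ Q ∈ normalizedFactors 𝔡, ¬ Q ∣ 𝔴 := by
  by_contra hno
  push Not at hno
  have h𝔡0 : (𝔡 : Ideal (𝓞 K)) ≠ 0 := by rwa [Ne, Ideal.zero_eq_bot]
  have h𝔴0 : (𝔴 : Ideal (𝓞 K)) ≠ 0 := by rwa [Ne, Ideal.zero_eq_bot]
  refine hnd ((dvd_iff_normalizedFactors_le_normalizedFactors h𝔡0 h𝔴0).2 ?_)
  rw [Multiset.le_iff_count]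
  intro Q
  by_cases hQ : Q ∈ normalizedFactors 𝔡
  · -- `v_Q(𝔡) = 1` (else the factor `b(Q, v) = 0`) and `v_Q(𝔴) ≥ 1`
    have hQw := hno Q hQ
    have hv1 : Multiset.count Q (normalizedFactors 𝔡) = 1 := by
      by_contra hne
      refine hB (Finset.prod_eq_zero (Multiset.mem_toFinset.2 hQ) ?_)
      simp only [sieveBloc, if_pos hQw]
      rw [if_neg hne]
    have hQp := prime_of_normalized_factor Q hQ
    obtain ⟨Q', hQ', hQQ'⟩ := exists_mem_normalizedFactors_of_dvd h𝔴0 hQp.irreducible hQw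
    rw [associated_iff_eq] at hQQ'
    rw [hv1, hQQ']
    exact Multiset.one_le_count_iff_mem.2 hQ'
  · rw [Multiset.count_eq_zero_of_notMem hQ]; exact Nat.zero_le _

/-- **`|β(x) − ∑_{𝔢∣𝔴} μ(𝔢)/N𝔢| ≤ D₀^{-1/4} · ∑_{N𝔡≤x} |B(𝔡)| N𝔡^{-3/4}`** when every prime of norm
`≤ D₀` divides `𝔴` and `x ≥ N𝔴` (the divisors of `𝔴` contribute `μ(𝔢)/N𝔢`; every other `𝔡` with
`B(𝔡) ≠ 0` has a prime factor of norm `> D₀`). [folklore] -/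
theorem abs_bsum_sub_dsum_le (h𝔴 : 𝔴 ≠ ⊥) {D₀ : ℝ} (hD₀ : 1 ≤ D₀)
    (hD : ∀ P : Ideal (𝓞 K), Prime P → (Ideal.absNorm P : ℝ) ≤ D₀ → P ∣ 𝔴) {x : ℝ}
    (hx : (Ideal.absNorm 𝔴 : ℝ) ≤ x) :
    |∑ 𝔡 ∈ idealsLE K x, sieveB 𝔴 c 𝔡 / ((Ideal.absNorm 𝔡 : ℕ) : ℝ) -
        ∑ 𝔢 ∈ idealDivisors K 𝔴, (idealMoebius 𝔢 : ℝ) / Ideal.absNorm 𝔢| ≤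
      D₀ ^ (-(1 : ℝ) / 4) *
        ∑ 𝔡 ∈ idealsLE K x, |sieveB 𝔴 c 𝔡| * ((Ideal.absNorm 𝔡 : ℕ) : ℝ) ^ (-(3 : ℝ) / 4) := by
  set A := idealsLE K x with hA
  -- split `A` according to `𝔡 ∣ 𝔴`
  have hdiv : ∑ 𝔡 ∈ A.filter (· ∣ 𝔴), sieveB 𝔴 c 𝔡 / ((Ideal.absNorm 𝔡 : ℕ) : ℝ) =
      ∑ 𝔢 ∈ idealDivisors K 𝔴, (idealMoebius 𝔢 : ℝ) / Ideal.absNorm 𝔢 := by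
    have hset : A.filter (· ∣ 𝔴) = idealDivisors K 𝔴 := by
      ext 𝔡
      rw [Finset.mem_filter, mem_idealDivisors h𝔴, hA, mem_idealsLE]
      constructor
      · exact fun h => h.2
      · intro h
        have h𝔡0 : 𝔡 ≠ ⊥ := by
          rintro rfl; rw [Ideal.dvd_iff_le, le_bot_iff] at h; exact h𝔴 h
        have hN𝔴 : Ideal.absNorm 𝔴 ≠ 0 := by rwa [Ne, Ideal.absNorm_eq_zero_iff]
        refine ⟨⟨h𝔡0, le_trans ?_ hx⟩, h⟩
        exact_mod_cast Nat.le_of_dvd (Nat.pos_of_ne_zero hN𝔴) (map_dvd _ h)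
    rw [hset]
    refine Finset.sum_congr rfl fun 𝔡 h𝔡 => ?_
    have hd := (mem_idealDivisors h𝔴).1 h𝔡
    have h𝔡0 := ne_bot_of_mem_idealDivisors h𝔴 h𝔡
    rw [sieveB_eq_idealMoebius 𝔴 c h𝔡0 fun P hP => (dvd_of_mem_normalizedFactors hP).trans hd]
  rw [← Finset.sum_filter_add_sum_filter_not A (· ∣ 𝔴), hdiv, add_sub_cancel_left]
  -- the remaining `𝔡 ∤ 𝔴` have `N𝔡 > D₀` unless `B(𝔡) = 0`
  have hD4 : 0 ≤ D₀ ^ (-(1 : ℝ) / 4) := by positivity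
  calc |∑ 𝔡 ∈ A.filter (fun 𝔡 => ¬ 𝔡 ∣ 𝔴), sieveB 𝔴 c 𝔡 / ((Ideal.absNorm 𝔡 : ℕ) : ℝ)|
      ≤ ∑ 𝔡 ∈ A.filter (fun 𝔡 => ¬ 𝔡 ∣ 𝔴), |sieveB 𝔴 c 𝔡 / ((Ideal.absNorm 𝔡 : ℕ) : ℝ)| :=
        Finset.abs_sum_le_sum_abs _ _
    _ ≤ ∑ 𝔡 ∈ A.filter (fun 𝔡 => ¬ 𝔡 ∣ 𝔴),
          D₀ ^ (-(1 : ℝ) / 4) * (|sieveB 𝔴 c 𝔡| * ((Ideal.absNorm 𝔡 : ℕ) : ℝ) ^ (-(3 : ℝ) / 4)) := by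
        refine Finset.sum_le_sum fun 𝔡 h𝔡 => ?_
        rw [Finset.mem_filter] at h𝔡
        have h𝔡0 := (mem_idealsLE.1 h𝔡.1).1
        by_cases hB : sieveB 𝔴 c 𝔡 = 0
        · rw [hB]; simp
        obtain ⟨Q, hQ, hQw⟩ := exists_factor_not_dvd_of_sieveB_ne_zero 𝔴 c h𝔡0 h𝔴 hB h𝔡.2
        have hQp := prime_of_normalized_factor Q hQ
        have hQD : D₀ < Ideal.absNorm Q := by
          by_contra hle; exact hQw (hD Q hQp (not_lt.1 hle))
        have hN𝔡 : Ideal.absNorm 𝔡 ≠ 0 := by rwa [Ne, Ideal.absNorm_eq_zero_iff]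
        have hQN' : Ideal.absNorm Q ≤ Ideal.absNorm 𝔡 :=
          Nat.le_of_dvd (Nat.pos_of_ne_zero hN𝔡) (map_dvd _ (dvd_of_mem_normalizedFactors hQ))
        have hQN : (Ideal.absNorm Q : ℝ) ≤ ((Ideal.absNorm 𝔡 : ℕ) : ℝ) := by exact_mod_cast hQN'
        have hND : D₀ < ((Ideal.absNorm 𝔡 : ℕ) : ℝ) := hQD.trans_le hQN
        have hN0 : 0 < ((Ideal.absNorm 𝔡 : ℕ) : ℝ) := by linarith
        rw [abs_div, abs_of_pos hN0]
        -- `1/N = N^{-3/4} N^{-1/4} ≤ N^{-3/4} D₀^{-1/4}`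
        have hsplit : |sieveB 𝔴 c 𝔡| / ((Ideal.absNorm 𝔡 : ℕ) : ℝ) =
            |sieveB 𝔴 c 𝔡| * ((Ideal.absNorm 𝔡 : ℕ) : ℝ) ^ (-(3 : ℝ) / 4) *
              ((Ideal.absNorm 𝔡 : ℕ) : ℝ) ^ (-(1 : ℝ) / 4) := by
          rw [mul_assoc, ← Real.rpow_add hN0, div_eq_mul_inv, ← Real.rpow_neg_one]; norm_num
        rw [hsplit, mul_comm (D₀ ^ (-(1 : ℝ) / 4))]
        refine mul_le_mul_of_nonneg_left ?_ (by positivity)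
        exact Real.rpow_le_rpow_of_nonpos (by linarith) hND.le (by norm_num)
    _ ≤ D₀ ^ (-(1 : ℝ) / 4) *
          ∑ 𝔡 ∈ A, |sieveB 𝔴 c 𝔡| * ((Ideal.absNorm 𝔡 : ℕ) : ℝ) ^ (-(3 : ℝ) / 4) := by
        rw [← Finset.mul_sum]
        refine mul_le_mul_of_nonneg_left ?_ hD4
        exact Finset.sum_le_sum_of_subset_of_nonneg (Finset.filter_subset _ _) fun _ _ _ => by positivity

/-- The weight for `c_P = 1/(NP−1)`: on square-free `𝔲` coprime to `𝔴`, `W(𝔲)/N𝔲 = 1/φ(𝔲)` with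
`φ(𝔲) = ∏_{P∣𝔲}(NP − 1)`; otherwise `0`. [folklore] -/
theorem sieveW_totient_div_absNorm {𝔲 : Ideal (𝓞 K)} (h𝔲 : 𝔲 ≠ ⊥) :
    sieveW 𝔴 (fun P => 1 / ((Ideal.absNorm P : ℝ) - 1)) 𝔲 / ((Ideal.absNorm 𝔲 : ℕ) : ℝ) =
      if 𝔲 ⊔ 𝔴 = ⊤ ∧ Squarefree 𝔲 then
        ∏ P ∈ (normalizedFactors 𝔲).toFinset, 1 / ((Ideal.absNorm P : ℝ) - 1) else 0 := by
  have h𝔲0 : (𝔲 : Ideal (𝓞 K)) ≠ 0 := by rwa [Ne, Ideal.zero_eq_bot]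
  rw [sieveW]
  split_ifs with h
  · have hnd := (squarefree_iff_nodup_normalizedFactors h𝔲0).1 h.2
    rw [absNorm_eq_prod_pow h𝔲, ← Finset.prod_div_distrib]
    refine Finset.prod_congr rfl fun P hP => ?_
    have hP' := Multiset.mem_toFinset.1 hP
    have h1 : Multiset.count P (normalizedFactors 𝔲) = 1 := by
      have := Multiset.nodup_iff_count_le_one.1 hnd P
      have := Multiset.one_le_count_iff_mem.2 hP'
      omega
    have hN2 : (2 : ℝ) ≤ Ideal.absNorm P := by
      exact_mod_cast two_le_absNorm_of_prime (prime_of_normalized_factor P hP')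
    have hN1 : (Ideal.absNorm P : ℝ) - 1 ≠ 0 := by linarith
    have hN0 : (Ideal.absNorm P : ℝ) ≠ 0 := by linarith
    rw [h1, pow_one]
    field_simp
    ring
  · rw [zero_div]

/-- **The general one-dimensional sieve sum with its limiting constant**: there are `C, Z` (depending
on `K` only) such that for every nonzero `𝔴`, all weights `|c_P| ≤ C₀/NP` (`C₀ ≥ 0`), every `D₀ ≥ 1`
such that each prime of norm `≤ D₀` divides `𝔴`, and every `x ≥ N𝔴`,
`|∑_{0<N𝔲≤x} W(𝔲)/N𝔲 − ρ_K (∑_{𝔢∣𝔴} μ(𝔢)/N𝔢) log x| ≤ C exp((1+2C₀)Z) 2^{ω(𝔴)} (1 + D₀^{-1/4} log x)`.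
[cite: CastilloEtAl2015, §2.2] -/
theorem abs_sum_sieveW_div_sub_dsum_le :
    ∃ C Z : ℝ, 0 ≤ C ∧ 0 ≤ Z ∧ ∀ (𝔴 : Ideal (𝓞 K)), 𝔴 ≠ ⊥ → ∀ (c : Ideal (𝓞 K) → ℝ) (C₀ : ℝ), 0 ≤ C₀ →
      (∀ P : Ideal (𝓞 K), Prime P → |c P| ≤ C₀ / Ideal.absNorm P) → ∀ D₀ : ℝ, 1 ≤ D₀ →
      (∀ P : Ideal (𝓞 K), Prime P → (Ideal.absNorm P : ℝ) ≤ D₀ → P ∣ 𝔴) →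
      ∀ x : ℝ, (Ideal.absNorm 𝔴 : ℝ) ≤ x →
      |∑ 𝔲 ∈ idealsLE K x, sieveW 𝔴 c 𝔲 / ((Ideal.absNorm 𝔲 : ℕ) : ℝ) -
          NumberField.dedekindZeta_residue K *
            (∑ 𝔢 ∈ idealDivisors K 𝔴, (idealMoebius 𝔢 : ℝ) / Ideal.absNorm 𝔢) * Real.log x| ≤
        C * Real.exp ((1 + 2 * C₀) * Z) * 2 ^ (normalizedFactors 𝔴).toFinset.card *
          (1 + D₀ ^ (-(1 : ℝ) / 4) * Real.log x) := by
  obtain ⟨C_H, hmain⟩ := abs_sum_sieveW_div_sub_le (K := K)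
  set ρ : ℝ := NumberField.dedekindZeta_residue K with hρ
  have hρ0 : 0 < ρ := NumberField.dedekindZeta_residue_pos K
  set Z : ℝ := ∑' v : IsDedekindDomain.HeightOneSpectrum (𝓞 K),
    ((Ideal.absNorm v.asIdeal : ℕ) : ℝ) ^ (-(3 : ℝ) / 2) with hZ
  have hZsum : Summable fun v : IsDedekindDomain.HeightOneSpectrum (𝓞 K) =>
      ((Ideal.absNorm v.asIdeal : ℕ) : ℝ) ^ (-(3 : ℝ) / 2) := by
    have := summable_absNorm_rpow_neg (K := K) (s := 3 / 2) (by norm_num)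
    refine this.congr fun v => ?_
    norm_num
  have hZ0 : 0 ≤ Z := tsum_nonneg fun v => by positivity
  refine ⟨|C_H| + 4 * ρ + ρ, Z, by positivity, hZ0, fun 𝔴 h𝔴 c C₀ hC₀ hc D₀ hD₀ hD x hx => ?_⟩
  have hN𝔴 : (1 : ℝ) ≤ Ideal.absNorm 𝔴 := by
    exact_mod_cast Nat.one_le_iff_ne_zero.2 (by rwa [Ne, Ideal.absNorm_eq_zero_iff])
  have hx1 : 1 ≤ x := hN𝔴.trans hx
  have h1 := hmain 𝔴 h𝔴 c C₀ hC₀ hc x hx1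
  have h2 := abs_bsum_sub_dsum_le 𝔴 c h𝔴 hD₀ hD hx
  have hmaj := sum_abs_sieveB_mul_rpow_le 𝔴 c hC₀ hc h𝔴 x
  -- the `x`-dependent majorant is at most `2^ω exp((1+2C₀) Z)`
  set ω := (normalizedFactors 𝔴).toFinset.card with hω
  have hT : ∑ P ∈ (finite_primeIdealsLE K x).toFinset, ((Ideal.absNorm P : ℕ) : ℝ) ^ (-(3 : ℝ) / 2) ≤ Z :=
    sum_primeIdealsLE_le_tsum (g := fun P => ((Ideal.absNorm P : ℕ) : ℝ) ^ (-(3 : ℝ) / 2))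
      (fun P => by positivity) hZsum x
  set M : ℝ := ∑ 𝔡 ∈ idealsLE K x, |sieveB 𝔴 c 𝔡| * ((Ideal.absNorm 𝔡 : ℕ) : ℝ) ^ (-(3 : ℝ) / 4)
    with hM
  have hM0 : 0 ≤ M := Finset.sum_nonneg fun _ _ => by positivity
  have h12 : 0 ≤ 1 + 2 * C₀ := by linarith
  have hBC : (2 : ℝ) ^ ω * Real.exp ((1 + 2 * C₀) *
      ∑ P ∈ (finite_primeIdealsLE K x).toFinset, ((Ideal.absNorm P : ℕ) : ℝ) ^ (-(3 : ℝ) / 2)) ≤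
      2 ^ ω * Real.exp ((1 + 2 * C₀) * Z) :=
    mul_le_mul_of_nonneg_left (Real.exp_le_exp.2 (mul_le_mul_of_nonneg_left hT h12)) (by positivity)
  have hMle : M ≤ 2 ^ ω * Real.exp ((1 + 2 * C₀) * Z) := hmaj.trans hBC
  set S := ∑ 𝔲 ∈ idealsLE K x, sieveW 𝔴 c 𝔲 / ((Ideal.absNorm 𝔲 : ℕ) : ℝ) with hSdef
  set β := ∑ 𝔡 ∈ idealsLE K x, sieveB 𝔴 c 𝔡 / ((Ideal.absNorm 𝔡 : ℕ) : ℝ) with hβ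
  set d := ∑ 𝔢 ∈ idealDivisors K 𝔴, (idealMoebius 𝔢 : ℝ) / Ideal.absNorm 𝔢 with hd
  have hlog0 : 0 ≤ Real.log x := Real.log_nonneg hx1
  have hD4 : 0 ≤ D₀ ^ (-(1 : ℝ) / 4) := by positivity
  -- `|S − ρ d log x| ≤ |S − ρ β log x| + ρ log x |β − d|`
  have hsplit : S - ρ * d * Real.log x = (S - ρ * β * Real.log x) + ρ * Real.log x * (β - d) := by ring
  rw [hsplit]
  refine (abs_add_le _ _).trans ?_
  set E2 : ℝ := 2 ^ ω * Real.exp ((1 + 2 * C₀) * Z) with hE2def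
  have hE2 : 0 ≤ E2 := by positivity
  have hA : |S - ρ * β * Real.log x| ≤ (|C_H| + 4 * ρ) * E2 := by
    refine h1.trans ?_
    calc (C_H + 4 * ρ) * ((2 : ℝ) ^ ω * Real.exp ((1 + 2 * C₀) *
          ∑ P ∈ (finite_primeIdealsLE K x).toFinset, ((Ideal.absNorm P : ℕ) : ℝ) ^ (-(3 : ℝ) / 2)))
        ≤ (|C_H| + 4 * ρ) * ((2 : ℝ) ^ ω * Real.exp ((1 + 2 * C₀) *
          ∑ P ∈ (finite_primeIdealsLE K x).toFinset, ((Ideal.absNorm P : ℕ) : ℝ) ^ (-(3 : ℝ) / 2))) :=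
          mul_le_mul_of_nonneg_right (by linarith [le_abs_self C_H]) (by positivity)
      _ ≤ (|C_H| + 4 * ρ) * E2 := mul_le_mul_of_nonneg_left hBC (by positivity)
  have hB : |ρ * Real.log x * (β - d)| ≤ ρ * Real.log x * (D₀ ^ (-(1 : ℝ) / 4) * E2) := by
    rw [abs_mul, abs_of_nonneg (mul_nonneg hρ0.le hlog0)]
    refine mul_le_mul_of_nonneg_left (h2.trans ?_) (mul_nonneg hρ0.le hlog0)
    exact mul_le_mul_of_nonneg_left hMle hD4
  refine (add_le_add hA hB).trans ?_
  have hL : 0 ≤ D₀ ^ (-(1 : ℝ) / 4) * Real.log x := mul_nonneg hD4 hlog0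
  have habs : 0 ≤ |C_H| := abs_nonneg _
  have hkey : (|C_H| + 4 * ρ) * E2 + ρ * Real.log x * (D₀ ^ (-(1 : ℝ) / 4) * E2) ≤
      (|C_H| + 4 * ρ + ρ) * E2 * (1 + D₀ ^ (-(1 : ℝ) / 4) * Real.log x) := by
    nlinarith [mul_nonneg hE2 hL, mul_nonneg habs (mul_nonneg hE2 hL), hρ0.le,
      mul_nonneg hρ0.le (mul_nonneg hE2 hL), mul_nonneg hρ0.le hE2]
  refine hkey.trans (le_of_eq ?_)
  rw [hE2def]; ring

/-- **`∑_{N𝔲 ≤ x, (𝔲,𝔴)=1} μ²(𝔲)/φ(𝔲) = ρ_K (φ(𝔴)/N𝔴) log x + O(…)`** — the number-field analogue of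
Maynard's (5.13)/(6.5) (`Literature.NumberTheory.Sieve.SquarefreeSums.abs_sum_inv_totient_sub_le`
over `ℤ`) and the estimate "`∑_{N𝔲<R,(𝔲,𝔴)=1} μ²(𝔲)/φ(𝔲) ≪ φ(𝔴) log R/|𝔴|`" of Castillo et al.:
there is `C = C_K` such that for every nonzero `𝔴`, every `D₀ ≥ 1` such that each prime of norm
`≤ D₀` divides `𝔴`, and every `x ≥ N𝔴`,
`|∑ 1/φ(𝔲) − ρ_K (∑_{𝔢∣𝔴} μ(𝔢)/N𝔢) log x| ≤ C · 2^{ω(𝔴)} · (1 + D₀^{-1/4} log x)`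
(`φ(𝔲) = ∏_{P∣𝔲}(NP−1)`, `∑_{𝔢∣𝔴} μ(𝔢)/N𝔢 = φ(𝔴)/N𝔴`, `ω(𝔴)` the number of prime factors).
[cite: CastilloEtAl2015, §2.2 (∑_{N𝔲<R,(𝔲,𝔴)=1} μ²(𝔲)/φ(𝔲) ≪ φ(𝔴) log R/|𝔴|)] -/
theorem abs_sum_inv_totientIdeal_sub_le :
    ∃ C : ℝ, ∀ (𝔴 : Ideal (𝓞 K)), 𝔴 ≠ ⊥ → ∀ D₀ : ℝ, 1 ≤ D₀ →
      (∀ P : Ideal (𝓞 K), Prime P → (Ideal.absNorm P : ℝ) ≤ D₀ → P ∣ 𝔴) →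
      ∀ x : ℝ, (Ideal.absNorm 𝔴 : ℝ) ≤ x →
      |∑ 𝔲 ∈ (idealsLE K x).filter (fun 𝔲 => 𝔲 ⊔ 𝔴 = ⊤ ∧ Squarefree 𝔲),
          ∏ P ∈ (normalizedFactors 𝔲).toFinset, 1 / ((Ideal.absNorm P : ℝ) - 1) -
          NumberField.dedekindZeta_residue K *
            (∑ 𝔢 ∈ idealDivisors K 𝔴, (idealMoebius 𝔢 : ℝ) / Ideal.absNorm 𝔢) * Real.log x| ≤
        C * 2 ^ (normalizedFactors 𝔴).toFinset.card * (1 + D₀ ^ (-(1 : ℝ) / 4) * Real.log x) := by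
  obtain ⟨C, Z, hC0, hZ0, h⟩ := abs_sum_sieveW_div_sub_dsum_le (K := K)
  refine ⟨C * Real.exp ((1 + 2 * 2) * Z), fun 𝔴 h𝔴 D₀ hD₀ hD x hx => ?_⟩
  set cT : Ideal (𝓞 K) → ℝ := fun P => 1 / ((Ideal.absNorm P : ℝ) - 1) with hcT
  have hcT_le : ∀ P : Ideal (𝓞 K), Prime P → |cT P| ≤ 2 / Ideal.absNorm P := by
    intro P hP
    have hN2 : (2 : ℝ) ≤ Ideal.absNorm P := by exact_mod_cast two_le_absNorm_of_prime hP
    rw [hcT]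
    dsimp only
    rw [abs_of_pos (by apply div_pos one_pos; linarith), div_le_div_iff₀ (by linarith) (by linarith)]
    linarith
  have hS : ∑ 𝔲 ∈ (idealsLE K x).filter (fun 𝔲 => 𝔲 ⊔ 𝔴 = ⊤ ∧ Squarefree 𝔲),
      ∏ P ∈ (normalizedFactors 𝔲).toFinset, 1 / ((Ideal.absNorm P : ℝ) - 1) =
      ∑ 𝔲 ∈ idealsLE K x, sieveW 𝔴 cT 𝔲 / ((Ideal.absNorm 𝔲 : ℕ) : ℝ) := by
    rw [Finset.sum_filter]
    refine Finset.sum_congr rfl fun 𝔲 h𝔲 => ?_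
    rw [sieveW_totient_div_absNorm 𝔴 (mem_idealsLE.1 h𝔲).1]
  rw [hS]
  exact h 𝔴 h𝔴 cT 2 zero_le_two hcT_le D₀ hD₀ hD x hx

/-- The weight for `c_P = 2/(NP−2)` (`NP ≥ 3` off `𝔴`): on square-free `𝔲` coprime to `𝔴`,
`W(𝔲)/N𝔲 = 1/g(𝔲)` with `g(𝔲) = ∏_{P∣𝔲}(NP − 2)`; otherwise `0`. [folklore] -/
theorem sieveW_g_div_absNorm {𝔲 : Ideal (𝓞 K)} (h𝔲 : 𝔲 ≠ ⊥)
    (h3 : ∀ P ∈ normalizedFactors 𝔲, ¬ P ∣ 𝔴 → (3 : ℝ) ≤ Ideal.absNorm P) :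
    sieveW 𝔴 (fun P => 2 / ((Ideal.absNorm P : ℝ) - 2)) 𝔲 / ((Ideal.absNorm 𝔲 : ℕ) : ℝ) =
      if 𝔲 ⊔ 𝔴 = ⊤ ∧ Squarefree 𝔲 then
        ∏ P ∈ (normalizedFactors 𝔲).toFinset, 1 / ((Ideal.absNorm P : ℝ) - 2) else 0 := by
  have h𝔲0 : (𝔲 : Ideal (𝓞 K)) ≠ 0 := by rwa [Ne, Ideal.zero_eq_bot]
  rw [sieveW]
  split_ifs with h
  · have hnd := (squarefree_iff_nodup_normalizedFactors h𝔲0).1 h.2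
    have hno := (sup_eq_top_iff_forall_not_dvd h𝔲).1 h.1
    rw [absNorm_eq_prod_pow h𝔲, ← Finset.prod_div_distrib]
    refine Finset.prod_congr rfl fun P hP => ?_
    have hP' := Multiset.mem_toFinset.1 hP
    have h1 : Multiset.count P (normalizedFactors 𝔲) = 1 := by
      have := Multiset.nodup_iff_count_le_one.1 hnd P
      have := Multiset.one_le_count_iff_mem.2 hP'
      omega
    have hN3 : (3 : ℝ) ≤ Ideal.absNorm P := h3 P hP' (hno P hP')
    have hN2 : (Ideal.absNorm P : ℝ) - 2 ≠ 0 := by linarith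
    have hN0 : (Ideal.absNorm P : ℝ) ≠ 0 := by linarith
    rw [h1, pow_one]
    field_simp
    ring
  · rw [zero_div]

/-- **`∑_{N𝔲 ≤ x, (𝔲,𝔴)=1} μ²(𝔲)/g(𝔲) = ρ_K (φ(𝔴)/N𝔴) log x + O(…)`** with `g(𝔲) = ∏_{P∣𝔲}(NP − 2)`
(the analogue of `SquarefreeSums.abs_sum_inv_g_sub_le`, Maynard's (5.20)/(6.11)): for `D₀ ≥ 2`
such that each prime of norm `≤ D₀` divides `𝔴` (so `NP ≥ 3` for `P ∤ 𝔴`) and `x ≥ N𝔴`,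
`|∑ 1/g(𝔲) − ρ_K (∑_{𝔢∣𝔴} μ(𝔢)/N𝔢) log x| ≤ C 2^{ω(𝔴)} (1 + D₀^{-1/4} log x)`.
[cite: CastilloEtAl2015, §2.2] -/
theorem abs_sum_inv_gIdeal_sub_le :
    ∃ C : ℝ, ∀ (𝔴 : Ideal (𝓞 K)), 𝔴 ≠ ⊥ → ∀ D₀ : ℝ, 2 ≤ D₀ →
      (∀ P : Ideal (𝓞 K), Prime P → (Ideal.absNorm P : ℝ) ≤ D₀ → P ∣ 𝔴) →
      ∀ x : ℝ, (Ideal.absNorm 𝔴 : ℝ) ≤ x →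
      |∑ 𝔲 ∈ (idealsLE K x).filter (fun 𝔲 => 𝔲 ⊔ 𝔴 = ⊤ ∧ Squarefree 𝔲),
          ∏ P ∈ (normalizedFactors 𝔲).toFinset, 1 / ((Ideal.absNorm P : ℝ) - 2) -
          NumberField.dedekindZeta_residue K *
            (∑ 𝔢 ∈ idealDivisors K 𝔴, (idealMoebius 𝔢 : ℝ) / Ideal.absNorm 𝔢) * Real.log x| ≤
        C * 2 ^ (normalizedFactors 𝔴).toFinset.card * (1 + D₀ ^ (-(1 : ℝ) / 4) * Real.log x) := by
  obtain ⟨C, Z, hC0, hZ0, h⟩ := abs_sum_sieveW_div_sub_dsum_le (K := K)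
  refine ⟨C * Real.exp ((1 + 2 * 6) * Z), fun 𝔴 h𝔴 D₀ hD₀ hD x hx => ?_⟩
  set cG : Ideal (𝓞 K) → ℝ := fun P => 2 / ((Ideal.absNorm P : ℝ) - 2) with hcG
  -- primes not dividing `𝔴` have norm `> D₀ ≥ 2`, hence `≥ 3`
  have h3 : ∀ P : Ideal (𝓞 K), Prime P → ¬ P ∣ 𝔴 → (3 : ℝ) ≤ Ideal.absNorm P := by
    intro P hP hPw
    have hgt : D₀ < Ideal.absNorm P := by
      by_contra hle; exact hPw (hD P hP (not_lt.1 hle))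
    have h2 : (2 : ℕ) < Ideal.absNorm P := by exact_mod_cast hD₀.trans_lt hgt
    exact_mod_cast h2
  have hcG_le : ∀ P : Ideal (𝓞 K), Prime P → |cG P| ≤ 6 / Ideal.absNorm P := by
    intro P hP
    have hN2 : (2 : ℝ) ≤ Ideal.absNorm P := by exact_mod_cast two_le_absNorm_of_prime hP
    rw [hcG]
    dsimp only
    by_cases hPw : P ∣ 𝔴
    · -- here `NP` may be `2`, in which case `cG P = 2/0 = 0`
      rcases hN2.eq_or_lt with h2 | h2
      · rw [← h2]; norm_num
      · have hN3 : (3 : ℝ) ≤ Ideal.absNorm P := by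
          have : (2 : ℕ) < Ideal.absNorm P := by exact_mod_cast h2
          exact_mod_cast this
        rw [abs_of_pos (by apply div_pos two_pos; linarith),
          div_le_div_iff₀ (by linarith) (by linarith)]
        linarith
    · have hN3 := h3 P hP hPw
      rw [abs_of_pos (by apply div_pos two_pos; linarith),
        div_le_div_iff₀ (by linarith) (by linarith)]
      linarith
  have hS : ∑ 𝔲 ∈ (idealsLE K x).filter (fun 𝔲 => 𝔲 ⊔ 𝔴 = ⊤ ∧ Squarefree 𝔲),
      ∏ P ∈ (normalizedFactors 𝔲).toFinset, 1 / ((Ideal.absNorm P : ℝ) - 2) =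
      ∑ 𝔲 ∈ idealsLE K x, sieveW 𝔴 cG 𝔲 / ((Ideal.absNorm 𝔲 : ℕ) : ℝ) := by
    rw [Finset.sum_filter]
    refine Finset.sum_congr rfl fun 𝔲 h𝔲 => ?_
    rw [sieveW_g_div_absNorm 𝔴 (mem_idealsLE.1 h𝔲).1 fun P hP hPw =>
      h3 P (prime_of_normalized_factor P hP) hPw]
  rw [hS]
  exact h 𝔴 h𝔴 cG 6 (by norm_num) hcG_le D₀ (by linarith) hD x hx

/-! ### Tails: `∑_{(𝔲,𝔴)=1, 𝔲 ≠ 1} μ²(𝔲)/∏_{P∣𝔲}(NP − k)² ≪_k D₀^{-1/2}` -/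

open Literature.NumberTheory.Sieve.SquarefreeIdeal IsDedekindDomain in
/-- **Tails of the singular-series sums** (the analogue of
`SquarefreeSums.sum_inv_totient_sq_sub_one_le` / `sum_inv_g_sq_sub_one_le`, Maynard (5.19), (6.12)):
there is `Z = Z_K ≥ 0` such that for every `k : ℕ`, every nonzero `𝔴`, every `D₀ ≥ max(1, k)` such
that each prime of norm `≤ D₀` divides `𝔴`, and every `x`,
`∑_{0<N𝔲≤x, (𝔲,𝔴)=1, 𝔲 square-free, 𝔲 ≠ (1)} ∏_{P∣𝔲} 1/(NP − k)² ≤ (k+1)² Z exp((k+1)² Z) · D₀^{-1/2}`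
(each such `𝔲` is a product of distinct primes of norm in `(D₀, x]`, so the sum is at most
`∏_{D₀ < NP ≤ x}(1 + 1/(NP−k)²) − 1 ≤ t e^t`, `t = ∑_{NP > D₀} (k+1)²/NP² ≤ (k+1)² D₀^{-1/2} ∑_P NP^{-3/2}`).
[cite: CastilloEtAl2015, §2.2] -/
theorem sum_inv_prod_sub_sq_le :
    ∃ Z : ℝ, 0 ≤ Z ∧ ∀ (k : ℕ) (𝔴 : Ideal (𝓞 K)), 𝔴 ≠ ⊥ → ∀ D₀ : ℝ, 1 ≤ D₀ → (k : ℝ) ≤ D₀ →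
      (∀ P : Ideal (𝓞 K), Prime P → (Ideal.absNorm P : ℝ) ≤ D₀ → P ∣ 𝔴) → ∀ x : ℝ,
      ∑ 𝔲 ∈ (idealsLE K x).filter (fun 𝔲 => 𝔲 ⊔ 𝔴 = ⊤ ∧ Squarefree 𝔲 ∧ 𝔲 ≠ ⊤),
          ∏ P ∈ (normalizedFactors 𝔲).toFinset, 1 / ((Ideal.absNorm P : ℝ) - k) ^ 2 ≤
        ((k : ℝ) + 1) ^ 2 * Z * Real.exp (((k : ℝ) + 1) ^ 2 * Z) * D₀ ^ (-(1 : ℝ) / 2) := by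
  set Z : ℝ := ∑' v : HeightOneSpectrum (𝓞 K), ((Ideal.absNorm v.asIdeal : ℕ) : ℝ) ^ (-(3 : ℝ) / 2)
    with hZ
  have hZsum : Summable fun v : HeightOneSpectrum (𝓞 K) =>
      ((Ideal.absNorm v.asIdeal : ℕ) : ℝ) ^ (-(3 : ℝ) / 2) := by
    have := summable_absNorm_rpow_neg (K := K) (s := 3 / 2) (by norm_num)
    refine this.congr fun v => ?_
    norm_num
  have hZ0 : 0 ≤ Z := tsum_nonneg fun v => by positivity
  refine ⟨Z, hZ0, fun k 𝔴 h𝔴 D₀ hD₀ hkD hD x => ?_⟩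
  set κ : ℝ := ((k : ℝ) + 1) ^ 2 with hκ
  have hκ1 : 1 ≤ κ := by rw [hκ]; nlinarith [(Nat.cast_nonneg k : (0 : ℝ) ≤ k)]
  -- the finite set of height-one primes of norm in `(D₀, x]` not dividing `𝔴`
  set T : Finset (Ideal (𝓞 K)) := (finite_primeIdealsLE K x).toFinset with hT
  have hfin : (HeightOneSpectrum.asIdeal ⁻¹' (↑T : Set (Ideal (𝓞 K)))).Finite :=
    Set.Finite.preimage (fun v _ w _ h => HeightOneSpectrum.ext h) T.finite_toSet
  set P : Finset (HeightOneSpectrum (𝓞 K)) := hfin.toFinset.filter (fun v => ¬ v.asIdeal ∣ 𝔴) with hP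
  have hmemP : ∀ v, v ∈ P ↔ v.asIdeal ∈ T ∧ ¬ v.asIdeal ∣ 𝔴 := by
    intro v; rw [hP, Finset.mem_filter, Set.Finite.mem_toFinset, Set.mem_preimage, Finset.mem_coe]
  -- norms of the primes in `P` exceed `D₀ ≥ k`
  have hND : ∀ v ∈ P, D₀ < Ideal.absNorm v.asIdeal := by
    intro v hv
    by_contra hle
    exact ((hmemP v).1 hv).2 (hD _ v.prime (not_lt.1 hle))
  set h : HeightOneSpectrum (𝓞 K) → ℝ := fun v => 1 / ((Ideal.absNorm v.asIdeal : ℝ) - k) ^ 2 with hh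
  have hh0 : ∀ v ∈ P, 0 ≤ h v := fun v _ => by positivity
  -- `h v ≤ κ NP^{-3/2} D₀^{-1/2}` on `P`
  have hhle : ∀ v ∈ P, h v ≤ κ * ((Ideal.absNorm v.asIdeal : ℕ) : ℝ) ^ (-(3 : ℝ) / 2) * D₀ ^ (-(1 : ℝ) / 2) := by
    intro v hv
    have hNDv' : D₀ < Ideal.absNorm v.asIdeal := hND v hv
    have hk1 : (k : ℝ) < Ideal.absNorm v.asIdeal := hkD.trans_lt hNDv'
    have hk2 : k < Ideal.absNorm v.asIdeal := by exact_mod_cast hk1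
    have hk3 : (((k + 1 : ℕ) : ℝ)) ≤ ((Ideal.absNorm v.asIdeal : ℕ) : ℝ) := by exact_mod_cast hk2
    set N : ℝ := ((Ideal.absNorm v.asIdeal : ℕ) : ℝ) with hN
    have hNDv : D₀ < N := hNDv'
    have hNk : (k : ℝ) + 1 ≤ N := by push_cast at hk3; exact hk3
    have hN0 : 0 < N := by linarith
    -- `1/(N-k)^2 ≤ κ/N^2 = κ N^{-3/2} N^{-1/2} ≤ κ N^{-3/2} D₀^{-1/2}`
    have hstep : h v ≤ κ / N ^ 2 := by
      rw [hh]; dsimp only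
      rw [div_le_div_iff₀ (by nlinarith) (by positivity), one_mul, hκ]
      have : N ≤ ((k : ℝ) + 1) * (N - k) := by nlinarith
      nlinarith
    refine hstep.trans ?_
    rw [div_eq_mul_inv, ← Real.rpow_natCast N 2, ← Real.rpow_neg hN0.le, mul_assoc]
    refine mul_le_mul_of_nonneg_left ?_ (by linarith)
    rw [show (-((2 : ℕ) : ℝ)) = -(3 : ℝ) / 2 + -(1 : ℝ) / 2 by norm_num, Real.rpow_add hN0]
    refine mul_le_mul_of_nonneg_left ?_ (by positivity)
    exact Real.rpow_le_rpow_of_nonpos (by linarith) hNDv.le (by norm_num)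
  have hsumh : ∑ v ∈ P, h v ≤ κ * Z * D₀ ^ (-(1 : ℝ) / 2) := by
    refine (Finset.sum_le_sum hhle).trans ?_
    rw [← Finset.sum_mul, ← Finset.mul_sum]
    refine mul_le_mul_of_nonneg_right (mul_le_mul_of_nonneg_left ?_ (by linarith)) (by positivity)
    exact hZsum.sum_le_tsum P fun v _ => by positivity
  have hD2 : D₀ ^ (-(1 : ℝ) / 2) ≤ 1 := Real.rpow_le_one_of_one_le_of_nonpos hD₀ (by norm_num)
  have hsumh' : ∑ v ∈ P, h v ≤ κ * Z := by
    refine hsumh.trans ?_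
    have : 0 ≤ κ * Z := by positivity
    nlinarith
  -- the sum, with `𝔲 = (1)` adjoined, is bounded by the Euler product over `P`
  set g : Ideal (𝓞 K) → ℝ := fun 𝔲 =>
    ∏ Q ∈ (normalizedFactors 𝔲).toFinset, 1 / ((Ideal.absNorm Q : ℝ) - k) ^ 2 with hg
  have hgS : ∀ S ⊆ P, g (prodIdeal S) = ∏ v ∈ S, h v := by
    intro S _
    rw [hg]; dsimp only
    rw [normalizedFactors_prodIdeal, Multiset.toFinset_map, Finset.val_toFinset,
      Finset.prod_image fun v _ w _ hvw => HeightOneSpectrum.ext hvw]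
  set U := (idealsLE K x).filter (fun 𝔲 => 𝔲 ⊔ 𝔴 = ⊤ ∧ Squarefree 𝔲 ∧ 𝔲 ≠ ⊤) with hU
  have hUmem : ∀ 𝔲 ∈ U, ∃ S ⊆ P, 𝔲 = prodIdeal S := by
    intro 𝔲 h𝔲
    rw [hU, Finset.mem_filter] at h𝔲
    obtain ⟨h𝔲A, hcop, hsq, -⟩ := h𝔲
    have h𝔲0 : (𝔲 : Ideal (𝓞 K)) ≠ 0 := by rw [Ne, Ideal.zero_eq_bot]; exact (mem_idealsLE.1 h𝔲A).1
    obtain ⟨S, hS, rfl⟩ := exists_eq_prodIdeal_subset_of_absNorm_le K h𝔲0 hsq (mem_idealsLE.1 h𝔲A).2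
    refine ⟨S, fun v hv => (hmemP v).2 ⟨hS v hv, fun hvw => ?_⟩, rfl⟩
    have hv𝔲 : v.asIdeal ∣ prodIdeal S := dvd_prodIdeal_iff.2 hv
    have hno := (sup_eq_top_iff_forall_not_dvd (mem_idealsLE.1 h𝔲A).1).1 hcop
    obtain ⟨Q, hQ, hvQ⟩ := exists_mem_normalizedFactors_of_dvd h𝔲0 v.irreducible hv𝔲
    rw [associated_iff_eq] at hvQ
    exact hno Q hQ (hvQ ▸ hvw)
  have htop : (⊤ : Ideal (𝓞 K)) ∉ U := by
    rw [hU, Finset.mem_filter]; exact fun h => h.2.2.2 rfl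
  have hbound := sum_le_prod_one_add P hh0 hgS (insert ⊤ U) (by
    intro 𝔲 h𝔲
    rcases Finset.mem_insert.1 h𝔲 with rfl | h𝔲
    · exact ⟨∅, Finset.empty_subset _, prodIdeal_empty.symm⟩
    · exact hUmem 𝔲 h𝔲)
  rw [Finset.sum_insert htop] at hbound
  have hg1 : g ⊤ = 1 := by
    rw [hg]; dsimp only
    rw [← Ideal.one_eq_top, normalizedFactors_one]; simp
  rw [hg1] at hbound
  -- `∏(1 + h) − 1 ≤ t e^t` with `t = ∑ h`
  have hprod : ∏ v ∈ P, (1 + h v) ≤ Real.exp (∑ v ∈ P, h v) := by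
    rw [Real.exp_sum]
    exact Finset.prod_le_prod (fun v hv => by linarith [hh0 v hv]) fun v _ => by
      linarith [Real.add_one_le_exp (h v)]
  have ht0 : 0 ≤ ∑ v ∈ P, h v := Finset.sum_nonneg hh0
  have hexp : Real.exp (∑ v ∈ P, h v) - 1 ≤ (∑ v ∈ P, h v) * Real.exp (∑ v ∈ P, h v) := by
    -- `e^t - 1 ≤ t e^t` for `t ≥ 0`
    have := Real.add_one_le_exp (-(∑ v ∈ P, h v))
    have hpos := Real.exp_pos (∑ v ∈ P, h v)
    have hmul : Real.exp (-(∑ v ∈ P, h v)) * Real.exp (∑ v ∈ P, h v) = 1 := by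
      rw [← Real.exp_add]; simp
    nlinarith
  have hfinal : ∑ 𝔲 ∈ U, g 𝔲 ≤ (∑ v ∈ P, h v) * Real.exp (∑ v ∈ P, h v) := by linarith
  refine hfinal.trans ?_
  calc (∑ v ∈ P, h v) * Real.exp (∑ v ∈ P, h v)
      ≤ (κ * Z * D₀ ^ (-(1 : ℝ) / 2)) * Real.exp (κ * Z) :=
        mul_le_mul hsumh (Real.exp_le_exp.2 hsumh') (Real.exp_pos _).le (by positivity)
    _ = κ * Z * Real.exp (κ * Z) * D₀ ^ (-(1 : ℝ) / 2) := by ring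

/-! ### The density `∑_{𝔢∣𝔴} μ(𝔢)/N𝔢 = ∏_{P∣𝔴} (1 − 1/NP) = φ(𝔴)/N𝔴` -/

/-- **`∑_{𝔢 ∣ 𝔴} μ(𝔢)/N𝔢 = ∏_{P ∣ 𝔴}(1 − 1/NP)`** for `𝔴 ≠ 0` (`μ(𝔢)/N𝔢` is the multiplicative
function with `b(P,1) = −1/NP`, `b(P, j≥2) = 0`; apply `sum_divisors_ppMul`). [folklore] -/
theorem dsum_eq_prod_one_sub_inv {𝔴 : Ideal (𝓞 K)} (h𝔴 : 𝔴 ≠ ⊥) :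
    ∑ 𝔢 ∈ idealDivisors K 𝔴, (idealMoebius 𝔢 : ℝ) / Ideal.absNorm 𝔢 =
      ∏ P ∈ (normalizedFactors 𝔴).toFinset, (1 - 1 / (Ideal.absNorm P : ℝ)) := by
  set b : Ideal (𝓞 K) → ℕ → ℝ := fun P j => if j = 1 then -(1 / (Ideal.absNorm P : ℝ)) else 0 with hb
  -- `μ(𝔢)/N𝔢 = ppMul b 𝔢` on nonzero ideals
  have hppMul : ∀ 𝔢 : Ideal (𝓞 K), 𝔢 ≠ ⊥ → (idealMoebius 𝔢 : ℝ) / Ideal.absNorm 𝔢 = ppMul b 𝔢 := by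
    intro 𝔢 h𝔢
    have h𝔢0 : (𝔢 : Ideal (𝓞 K)) ≠ 0 := by rwa [Ne, Ideal.zero_eq_bot]
    rw [ppMul]
    by_cases hsq : Squarefree 𝔢
    · have hnd := (squarefree_iff_nodup_normalizedFactors h𝔢0).1 hsq
      have hN : ((Ideal.absNorm 𝔢 : ℕ) : ℝ) = ∏ P ∈ (normalizedFactors 𝔢).toFinset, (Ideal.absNorm P : ℝ) := by
        rw [absNorm_eq_prod_pow h𝔢]
        refine Finset.prod_congr rfl fun P hP => ?_
        have h1 : Multiset.count P (normalizedFactors 𝔢) = 1 := by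
          have := Multiset.nodup_iff_count_le_one.1 hnd P
          have := Multiset.one_le_count_iff_mem.2 (Multiset.mem_toFinset.1 hP)
          omega
        rw [h1, pow_one]
      rw [idealMoebius_apply_of_squarefree hsq, ← Multiset.toFinset_card_of_nodup hnd, hN]
      push_cast
      rw [← Finset.prod_const, ← Finset.prod_div_distrib]
      refine Finset.prod_congr rfl fun P hP => ?_
      have h1 : Multiset.count P (normalizedFactors 𝔢) = 1 := by
        have := Multiset.nodup_iff_count_le_one.1 hnd P
        have := Multiset.one_le_count_iff_mem.2 (Multiset.mem_toFinset.1 hP)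
        omega
      rw [hb]; dsimp only
      rw [h1, if_pos rfl, neg_div, one_div]
    · rw [idealMoebius_apply_of_not_squarefree hsq, Int.cast_zero, zero_div]
      have : ∃ P ∈ (normalizedFactors 𝔢).toFinset, 2 ≤ Multiset.count P (normalizedFactors 𝔢) := by
        by_contra hno
        push Not at hno
        refine hsq ((squarefree_iff_nodup_normalizedFactors h𝔢0).2 ?_)
        rw [Multiset.nodup_iff_count_le_one]
        intro P
        by_cases hP : P ∈ (normalizedFactors 𝔢).toFinset
        · have := hno P hP; omega
        · rw [Multiset.mem_toFinset] at hP
          rw [Multiset.count_eq_zero_of_notMem hP]; omega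
      obtain ⟨P, hP, h2⟩ := this
      symm
      refine Finset.prod_eq_zero hP ?_
      rw [hb]; dsimp only
      rw [if_neg (by omega)]
  rw [Finset.sum_congr rfl fun 𝔢 h𝔢 => hppMul 𝔢 (ne_bot_of_mem_idealDivisors h𝔴 h𝔢),
    sum_divisors_ppMul b h𝔴 (fun 𝔡 => mem_idealDivisors h𝔴)]
  refine Finset.prod_congr rfl fun P hP => ?_
  have hv : 1 ≤ Multiset.count P (normalizedFactors 𝔴) :=
    Multiset.one_le_count_iff_mem.2 (Multiset.mem_toFinset.1 hP)
  -- `∑_{j ≤ v} b₀(P, j) = 1 − 1/NP`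
  rw [← Finset.sum_range_add_sum_Ico _ (by omega : 2 ≤ Multiset.count P (normalizedFactors 𝔴) + 1),
    Finset.sum_eq_zero (s := Finset.Ico 2 _) fun j hj => by
      rw [if_neg (by have := (Finset.mem_Ico.1 hj).1; omega), hb]
      dsimp only
      rw [if_neg (by have := (Finset.mem_Ico.1 hj).1; omega)]]
  simp [Finset.sum_range_succ, hb, sub_eq_add_neg]

end Literature.NumberTheory.Sieve.IdealSieve
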